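import Mathlib
import Summits.PneNP.PneNP.Theorems.ClusUniversalCertificateCubeA

/-!
# Route ClusUniversalCertificate — the GRADED vanishing lemma (engine of the graded rank method)
(rung F-N1, cell pnp-ideate; helper for stmt-PneNP-19683 `UniversalCertAll`; record HOME/pnp-ideate-prover-2/g10/MEMO-graded-rank.md §1)

`ClusCube.lemmaZ` (the engine of the PROVED hypercube case `universalCert_one`, ROUND-5 §T Lemma Z) says: a polynomial over `𝔽₂` of
total degree `≤ d` that vanishes at every point of the cube with at most `d` zero coordinates vanishes everywhere.  This file proves the
version for an ARBITRARY DOWN-CLOSED FAMILY `𝓣` of monomial supports in place of `{T : |T| ≤ d}`: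

* `eval_pt_eq_sum_cT`: at a 0/1 point `pt S` a polynomial evaluates to the LOWER SUM `Σ_{T ⊆ S} c_T` of its collapsed (multilinear)
  coefficients `c_T = Σ_{supp d = T} coeff d`;
* `eval_eq_zero_of_vanish_on_downset` (**graded vanishing lemma**): if every monomial of `f` has support in `𝓣` and `f(pt S) = 0` for
  every `S ∈ 𝓣`, then `f ≡ 0` on the cube (triangular induction along `⊆`; no reflection `x ↦ x + 𝟙` needed in this orientation);
* `eval_eq_of_eq_on_downset`: two such polynomials agreeing on `{pt S : S ∈ 𝓣}` agree everywhere — i.e. the space of functions spanned by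
  the monomials `x_T, T ∈ 𝓣` restricts INJECTIVELY to the test set `H_𝓣 = {t : supp t ∈ 𝓣}`, so at most `|H_𝓣 ∩ Y|` functions supported
  on `Y` with monomials in `𝓣` are linearly independent (the capacity bound of the memo, for every block grading at once: tensor
  gradings, block-degree, and their GL-relabelled versions are all down-closed families).

HONEST FRAMING: an elementary lemma about multilinear polynomials over `𝔽₂` (finite Möbius inversion), offered as infrastructure for an
OPEN crux of route ClusUniversalCertificate (the block case `m ≥ 2`); it closes nothing; FRONTIER rung F-N1 — nothing here bears on P vs NP.
[folklore: lower sets are unisolvent on lower grids; ROUND-5 §T.7 remark "Lemma Z holds for any pair (𝓣, H)"]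
-/

set_option linter.dupNamespace false -- `Summit.PneNP.PneNP.…`: summit = sub-problem name (D-0017 single-conjunct layout)

namespace Summit.PneNP.PneNP.Theorems.ClusCubeGraded

open Classical Finset MvPolynomial
open Summit.PneNP.PneNP.Theorems.ClusCube (V supp pt pt_supp eval_pt)

noncomputable section

variable {N : ℕ}

/-- At the 0/1 point of `S`, `f` evaluates to the lower sum `Σ_{T ⊆ S} c_T` of its collapsed (multilinear) coefficients
`c_T = Σ_{d : supp d = T} coeff_d f` (written out, no new definition). -/
lemma eval_pt_eq_sum_cT (f : MvPolynomial (Fin N) (ZMod 2)) (S : Finset (Fin N)) :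
    eval (pt S) f = ∑ T ∈ S.powerset, ∑ d ∈ f.support, (if d.support = T then f.coeff d else 0) := by
  rw [eval_pt, sum_comm]
  refine sum_congr rfl fun d _ => ?_
  rw [sum_ite_eq]
  simp only [mem_powerset]

/-- A collapsed coefficient at a support outside the support family of `f` vanishes. -/
lemma cT_eq_zero_of_forall_ne (f : MvPolynomial (Fin N) (ZMod 2)) (T : Finset (Fin N))
    (h : ∀ d ∈ f.support, d.support ≠ T) : (∑ d ∈ f.support, if d.support = T then f.coeff d else 0) = 0 :=
  sum_eq_zero fun d hd => if_neg (h d hd)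

/-- **Graded vanishing lemma.**  Let `𝓣` be a down-closed family of subsets of the coordinates.  If every monomial of `f` has its
support in `𝓣` and `f` vanishes at the 0/1 points `pt S`, `S ∈ 𝓣`, then `f` vanishes at every point of the cube. -/
theorem eval_eq_zero_of_vanish_on_downset (𝓣 : Finset (Finset (Fin N)))
    (hdown : ∀ T ∈ 𝓣, ∀ S, S ⊆ T → S ∈ 𝓣)
    (f : MvPolynomial (Fin N) (ZMod 2)) (hsupp : ∀ d ∈ f.support, d.support ∈ 𝓣)
    (hvan : ∀ S ∈ 𝓣, eval (pt S) f = 0) (x : V N) : eval x f = 0 := by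
  -- collapsed coefficients vanish outside `𝓣` (no monomial there) ...
  have hout : ∀ T, T ∉ 𝓣 → (∑ d ∈ f.support, if d.support = T then f.coeff d else 0) = 0 := fun T hT =>
    cT_eq_zero_of_forall_ne f T fun d hd hdT => hT (hdT ▸ hsupp d hd)
  -- ... and inside `𝓣` by induction along `⊆` (triangularity of the lower sums)
  have hin : ∀ T, T ∈ 𝓣 → (∑ d ∈ f.support, if d.support = T then f.coeff d else 0) = 0 := by
    intro T
    induction T using Finset.strongInduction with
    | H T ih =>
      intro hT
      have h := hvan T hT
      rw [eval_pt_eq_sum_cT, ← sum_erase_add _ _ (mem_powerset_self T)] at h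
      have hrest : ∑ T' ∈ T.powerset.erase T, (∑ d ∈ f.support, if d.support = T' then f.coeff d else 0) = 0 := by
        refine sum_eq_zero fun T' hT' => ?_
        obtain ⟨hne, hsub⟩ := mem_erase.mp hT'
        have hss : T' ⊂ T := ssubset_of_subset_of_ne (mem_powerset.mp hsub) hne
        exact ih T' hss (hdown T hT T' hss.subset)
      rw [hrest, zero_add] at h
      exact h
  have hall : ∀ T, (∑ d ∈ f.support, if d.support = T then f.coeff d else 0) = 0 :=
    fun T => if hT : T ∈ 𝓣 then hin T hT else hout T hT
  rw [← pt_supp x, eval_pt_eq_sum_cT]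
  exact sum_eq_zero fun T _ => hall T

/-- Injectivity form: two polynomials whose monomials have supports in the down-closed family `𝓣` and which agree on the test
points `pt S`, `S ∈ 𝓣`, agree on the whole cube. -/
theorem eval_eq_of_eq_on_downset (𝓣 : Finset (Finset (Fin N)))
    (hdown : ∀ T ∈ 𝓣, ∀ S, S ⊆ T → S ∈ 𝓣)
    (f g : MvPolynomial (Fin N) (ZMod 2)) (hf : ∀ d ∈ f.support, d.support ∈ 𝓣)
    (hg : ∀ d ∈ g.support, d.support ∈ 𝓣)
    (hagree : ∀ S ∈ 𝓣, eval (pt S) f = eval (pt S) g) (x : V N) : eval x f = eval x g := by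
  have hsupp : ∀ d ∈ (f - g).support, d.support ∈ 𝓣 := by
    intro d hd
    have hd' := support_sub (σ := Fin N) (R := ZMod 2) f g hd
    rcases mem_union.mp hd' with h | h
    · exact hf d h
    · exact hg d h
  have hvan : ∀ S ∈ 𝓣, eval (pt S) (f - g) = 0 := fun S hS => by
    rw [map_sub, hagree S hS, sub_self]
  have := eval_eq_zero_of_vanish_on_downset 𝓣 hdown (f - g) hsupp hvan x
  rwa [map_sub, sub_eq_zero] at this

/-- The degree filtration is the special case `𝓣 = {T : |T| ≤ d}`: a polynomial all of whose monomials have support of size `≤ d`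
and which vanishes at the 0/1 points of weight `≤ d` vanishes everywhere (the orientation dual to `ClusCube.lemmaZ`). -/
theorem eval_eq_zero_of_vanish_on_light (d : ℕ) (f : MvPolynomial (Fin N) (ZMod 2))
    (hsupp : ∀ e ∈ f.support, e.support.card ≤ d)
    (hvan : ∀ S : Finset (Fin N), S.card ≤ d → eval (pt S) f = 0) (x : V N) : eval x f = 0 := by
  refine eval_eq_zero_of_vanish_on_downset (univ.filter fun T : Finset (Fin N) => T.card ≤ d) ?_ f ?_ ?_ x
  · intro T hT S hS
    rw [mem_filter] at hT ⊢
    exact ⟨mem_univ _, (card_le_card hS).trans hT.2⟩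
  · intro e he
    exact mem_filter.mpr ⟨mem_univ _, hsupp e he⟩
  · intro S hS
    exact hvan S (mem_filter.mp hS).2

end

end Summit.PneNP.PneNP.Theorems.ClusCubeGraded
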